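import Mathlib
import Summits.Ventures.PercRepro2.LocRows
import Summits.Ventures.PercRepro2.SwRow
import Summits.Ventures.PercRepro2.SwOut
import Summits.Ventures.PercRepro2.SwAllRow
import Summits.Ventures.PercRepro2.SwOutAll
import Summits.Ventures.PercRepro2.SwOutArmFlip
import Summits.Ventures.PercRepro2.SwOutArmThm
import Summits.Ventures.PercRepro2.SwOutJunction
import Summits.Ventures.PercRepro2.SwOutJunctionRegion
import Summits.Ventures.PercRepro2.SwOutCoreDefs
import Summits.Ventures.PercRepro2.SwOutCoreKey
import Summits.Ventures.PercRepro2.SwOutJunctionH1Defs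
import Summits.Ventures.PercRepro2.SwOutJunctionH1Arms
import Summits.Ventures.PercRepro2.SwOutJunctionH1Cover
import Summits.Ventures.PercRepro2.SwOutJunctionH1Inside
import Summits.Ventures.PercRepro2.SwOutJunctionH1Base
import Summits.Ventures.PercRepro2.SwOutJunctionH1Kinds
import Summits.Ventures.PercRepro2.SwOutBigBlockDefs
import Summits.Ventures.PercRepro2.SwOutMixedBaseDefs
import Summits.Ventures.PercRepro2.SwOutMixedPartDefs

/-!
# The canonical base of a core-kind point with a red dead edge is a core base (blind cell
PercRepro2, night-4 g19, 2026-08-27; proofs/NIGHT4-G19.md §3)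

The other half of the dichotomy of `SwOutMixedPartBase`: for a core-kind `Q`-point `ζ` of a
class with a mixed single junction (`MixedJunction`), when SOME dead edge (`p`–`Ah`) is red at
the canonical base `b = coreBaseOf ζ`, the mixed arm `Ah ∪ {p}` is an ordinary h-arm — `p` is
red-connected to `h` inside the arm through that dead edge and its h-adjacent end (hypothesis
(b)) — and **`b` is a `CoreBase` on the arms of `ζ`** (`coreBase_of_coreKind_mix`), exactly as in
Theorem A (`coreBase_of_coreKind`), whose simple-arm hypothesis (H1) is replaced by (a), (b), (d)
of the mixed junction.  No arm is pure (every arm contains a neighbour of `h`).  The core cube of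
such a base has no dropped one-sided point: it is a block of the class by itself
(`card_coreCube_le`), the block of the core kind of Theorem A.  Inside connectivity of the mixed
arm: `armP_conn_red`.
-/

namespace Summit.Ventures.PercRepro2

namespace BigBlock

open Hull LocRows

variable {V : Type*} {E : Type*} [Fintype E] [DecidableEq E]

open scoped Classical

variable {ends : E → Sym2 V}

section Inside

variable {h u p : V} {η : Config E}

omit [DecidableEq E] in
/-- **Inside connectivity of the mixed arm on the red side with a red dead edge**: when the arm
of `p` lies on the red side, no u-edge enters it except at `p`, every neighbour of `p` in the arm
is adjacent to `h`, and some dead edge is red, every vertex of the arm is red-connected to `h`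
inside the arm with `h`. -/
theorem armP_conn_red
    (hdisj : ∀ x, x ∈ redExt ends h u η → x ∈ blueExt ends η h u → False)
    (hP : armC ends h u η p ∈ armsC ends h u η)
    (hPR : armC ends h u η p ⊆ redExt ends h u η)
    (hno_u : ∀ e x, ends e = s(u, x) → x ∈ armC ends h u η p → x = p)
    (hadj_h : ∀ e x, ends e = s(p, x) → x ∈ armC ends h u η p → x ≠ p → ∃ e', ends e' = s(x, h))
    (hred : ∃ e x, ends e = s(p, x) ∧ x ∈ armC ends h u η p ∧ x ≠ p ∧ η e = true) :
    ∀ x ∈ armC ends h u η p,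
      x ∈ cluster ends (insideConfig ends (armC ends h u η p ∪ {h}) η) h := by
  set A := armC ends h u η p with hA
  have hPsub := armsC_subset hP
  have hhA : h ∉ A := fun hh => (hPsub h hh).2.1 rfl
  have huA : u ∉ A := fun hu => (hPsub u hu).2.2 rfl
  -- `p` is red-connected to `h` inside the arm: through the red dead edge and its h-adjacent end
  have hpIn : p ∈ cluster ends (insideConfig ends (A ∪ {h}) η) h := by
    obtain ⟨e, y, hey, hyA, hyp, hered⟩ := hred
    obtain ⟨e', hye⟩ := hadj_h e y hey hyA hyp
    have hred' : η e' = true := by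
      by_contra hblue
      simp only [Bool.not_eq_true] at hblue
      have hb' : blue η e' = true := by rw [blue_eq_true_iff]; exact hblue
      have hyB : y ∈ blueExt ends η h u := by
        rw [mem_blueExt_iff]
        exact ⟨Or.inl (mem_cluster_of_edge (mem_cluster_self _ _ _) hb' (ends_swap hye)),
          (hPsub y hyA).2.1, (hPsub y hyA).2.2⟩
      exact hdisj y (hPR hyA) hyB
    have hin' : insideConfig ends (A ∪ {h}) η e' = true :=
      insideConfig_eq_true_iff.2 ⟨hred', h, Or.inr rfl, y, Or.inl hyA, ends_swap hye⟩
    have hyIn : y ∈ cluster ends (insideConfig ends (A ∪ {h}) η) h :=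
      mem_cluster_of_edge (mem_cluster_self _ _ _) hin' (ends_swap hye)
    have hin : insideConfig ends (A ∪ {h}) η e = true :=
      insideConfig_eq_true_iff.2 ⟨hered, y, Or.inl hyA, p, Or.inl (mem_armC_self p), ends_swap hey⟩
    exact mem_cluster_of_edge hyIn hin (ends_swap hey)
  let S : Set V := {v | v ∉ A ∨ v ∈ cluster ends (insideConfig ends (A ∪ {h}) η) h}
  have hclosed : ∀ a ∈ S, ∀ b, (openGraph ends η).Adj a b → b ∈ S := by
    intro a ha b hab
    obtain ⟨_, e, he, hends⟩ := openGraph_adj.1 hab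
    by_cases hbA : b ∈ A
    · right
      by_cases haA : a ∈ A
      · have hin : insideConfig ends (A ∪ {h}) η e = true :=
          insideConfig_eq_true_iff.2 ⟨he, a, Or.inl haA, b, Or.inl hbA, hends⟩
        rcases ha with ha | ha
        · exact absurd haA ha
        · exact mem_cluster_of_edge ha hin hends
      by_cases hah : a = h
      · rw [hah] at hends
        have hin : insideConfig ends (A ∪ {h}) η e = true :=
          insideConfig_eq_true_iff.2 ⟨he, h, Or.inr rfl, b, Or.inl hbA, hends⟩
        exact mem_cluster_of_edge (mem_cluster_self _ _ _) hin hends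
      by_cases hau : a = u
      · rw [hau] at hends
        rw [hno_u e b hends hbA]
        exact hpIn
      · exfalso
        exact haA (mem_armsC_of_red_edge hP hPR hends hbA he hah hau)
    · exact Or.inl hbA
  intro x hx
  have hxR := hPR hx
  rw [mem_redExt_iff] at hxR
  have hxS : x ∈ S := by
    rcases hxR.1 with hx' | hx'
    · exact mem_of_conn_of_closed hclosed (Or.inl hhA) hx'
    · exact mem_of_conn_of_closed hclosed (Or.inl huA) hx'
  rcases hxS with h' | h'
  · exact absurd hx h'
  · exact h'

end Inside

section Base

variable {U : Set V} {ξ : Config E} {l h o u p : V}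

variable (hj : MixedJunction ends U h u p o)
include hj

omit [DecidableEq E] in
/-- Every neighbour of `p` inside its arm is adjacent to `h` (when `H⁺ ⊆ U`). -/
lemma adj_h_of_mem_armP {ζ : Config E} (hHU : extHull ends ζ h u ⊆ U) {e : E} {x : V}
    (he : ends e = s(p, x)) (hx : x ∈ armC ends h u ζ p) (_hxp : x ≠ p) :
    ∃ e', ends e' = s(x, h) := by
  refine hj.hp_adj_h e x he (hHU (armsC_subset (armP_mem_armsC hj ζ) x hx).1) ?_
  intro hxu
  exact (armsC_subset (armP_mem_armsC hj ζ) x hx).2.2 hxu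

omit [DecidableEq E] in
/-- Every arm of a configuration of the class contains a neighbour of `h` (no arm is pure). -/
lemma armsC_not_pure {ζ : Config E} (hHU : extHull ends ζ h u ⊆ U) {P : Set V}
    (hP : P ∈ armsC ends h u ζ) : ∃ e y, ends e = s(h, y) ∧ y ∈ P := by
  obtain ⟨y, hyH, hyh, hyu, rfl⟩ := exists_of_mem_armsC hP
  -- the arm is reached from `h` or from `u`
  obtain ⟨y', hy', hy'h, hy'u, hy'H, hy'P⟩ : ∃ y', (∃ e, ends e = s(h, y') ∨ ends e = s(u, y')) ∧
      y' ≠ h ∧ y' ≠ u ∧ y' ∈ extHull ends ζ h u ∧ y' ∈ armC ends h u ζ y := by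
    have : armC ends h u ζ y ∈ armsC ends h u ζ := hP
    obtain ⟨e, he, hPe⟩ := Finset.mem_image.1 this
    obtain ⟨y', hy', hy'h, hy'u, hy'H, harm⟩ := exists_of_mem_junctionEdges he
    refine ⟨y', ⟨e, hy'⟩, hy'h, hy'u, hy'H, ?_⟩
    rw [← hPe, harm]
    exact mem_armC_self y'
  obtain ⟨e, he⟩ := hy'
  rcases he with he | he
  · exact ⟨e, y', he, hy'P⟩
  · -- from `u`: `y'` is `p` (then a dead-edge partner is adjacent to `h`) or h-adjacent by (a)
    by_cases hy'p : y' = p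
    · subst hy'p
      obtain ⟨e₁, z, hez, hzU, hzu⟩ := hj.hp_nbr
      obtain ⟨e₂, hzh⟩ := hj.hp_adj_h e₁ z hez hzU hzu
      have hzh' : z ≠ h := by
        rintro rfl
        exact hj.hnadj_p e₁ (ends_swap hez)
      have hzH : z ∈ extHull ends ζ h u := by
        cases hc : ζ e₂ with
        | true =>
          exact Or.inl (Or.inl (mem_cluster_of_edge (mem_cluster_self _ _ _) hc (ends_swap hzh)))
        | false =>
          have hc' : blue ζ e₂ = true := by rw [blue_eq_true_iff]; exact hc
          exact Or.inl (Or.inr (mem_cluster_of_edge (mem_cluster_self _ _ _) hc' (ends_swap hzh)))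
      refine ⟨e₂, z, ends_swap hzh, ?_⟩
      exact mem_armC_of_edge hy'P hy'H hy'h hy'u hzH hzh' hzu hez
    · obtain ⟨e', he'⟩ := hj.hu_adj_h e y' he hy'p
      exact ⟨e', y', ends_swap he', hy'P⟩

/-- **The canonical base of a core-kind `Q`-point with a red dead edge is a core base on its
arms** (the mixed arm `Ah ∪ {p}` being an h-arm; no arm is pure). -/
theorem coreBase_of_coreKind_mix (hl : l ∉ U) {ζ : Config E} (hζ : ζ ∈ swOutSide ends l h o U ξ)
    (hk : CoreKind ends U h u ζ)
    (hred : ∃ e x, ends e = s(p, x) ∧ x ∈ AhOf ends h u p ζ ∧ coreBaseOf ends ζ h u e = true) :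
    CoreBase ends (coreBaseOf ends ζ h u) h u (extHull ends ζ h u)
      (fun P : armsC ends h u ζ => P.1) (fun P => pureC ends h P.1) := by
  have hhu := hj.hne_hu
  have hdisj : ∀ x, x ∈ redExt ends h u ζ → x ∈ blueExt ends ζ h u → False :=
    fun x hxR hxB => redExt_disjoint_blueExt hl hj.hout hζ hk x hxR hxB
  have hnoRB : ∀ e x y, ends e = s(x, y) → x ∈ redExt ends h u ζ → y ∈ blueExt ends ζ h u →
      False := fun e x y hxy hx hy => no_edge_redExt_blueExt hdisj hxy hx hy
  have hHU : extHull ends ζ h u ⊆ U := extHull_subset_of_coreKind hζ hk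
  have hdisj' : ∀ x, x ∈ redExt ends h u (blue ζ) → x ∈ blueExt ends (blue ζ) h u → False := by
    intro x hxR hxB
    rw [redExt_blue] at hxR
    rw [blueExt_blue] at hxB
    exact hdisj x hxB hxR
  have hAP := armP_mem_armsC hj ζ
  have hpH : p ∈ extHull ends ζ h u := p_mem_extHull hj.hup ζ
  have hpP : p ∈ armC ends h u ζ p := mem_armC_self p
  have hno_u : ∀ e y, ends e = s(u, y) → y ∈ armC ends h u ζ p → y = p :=
    fun e y hey hy => eq_p_of_u_edge hj hHU hey hy
  -- the non-pure h-arm connectivity, on either side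
  have hconn : ∀ P ∈ armsC ends h u ζ, ∀ x ∈ P,
      x ∈ cluster ends (insideConfig ends (P ∪ {h}) (coreBaseOf ends ζ h u)) h := by
    intro P hP x hx
    by_cases hPp : P = armC ends h u ζ p
    · -- the mixed arm
      subst hPp
      have hadj : ∀ e y, ends e = s(p, y) → y ∈ armC ends h u ζ p → y ≠ p →
          ∃ e', ends e' = s(y, h) := fun e y hey hy hyp => adj_h_of_mem_armP hj hHU hey hy hyp
      obtain ⟨e₀, y₀, hey₀, hy₀, hred₀⟩ := hred
      rcases armsC_subset_side hnoRB hP with hPR | hPB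
      · rw [insideConfig_coreBaseOf_of_subset_red hPR (Or.inl rfl) hdisj]
        refine armP_conn_red hdisj hP hPR hno_u hadj ⟨e₀, y₀, hey₀, hy₀.1, hy₀.2, ?_⟩ x hx
        rw [← hred₀]
        exact (coreBaseOf_apply_of_notMem hey₀ (fun h' => hdisj p (hPR hpP) h')
          (fun h' => hdisj y₀ (hPR hy₀.1) h')).symm
      · rw [insideConfig_coreBaseOf_of_subset_blue hPB hj.hloop_h]
        have hE := armC_eq_of_extHull_eq (ends := ends) (h := h) (u := u) (ζ := ζ)
          (ζ' := blue ζ) extHull_blue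
        have hP' : armC ends h u (blue ζ) p ∈ armsC ends h u (blue ζ) := by
          rw [armsC_blue, hE]; exact hP
        have hPR' : armC ends h u (blue ζ) p ⊆ redExt ends h u (blue ζ) := by
          rw [redExt_blue, hE]; exact hPB
        have hno_u' : ∀ e y, ends e = s(u, y) → y ∈ armC ends h u (blue ζ) p → y = p := by
          intro e y hey hy
          rw [hE] at hy
          exact hno_u e y hey hy
        have hadj' : ∀ e y, ends e = s(p, y) → y ∈ armC ends h u (blue ζ) p → y ≠ p →
            ∃ e', ends e' = s(y, h) := by
          intro e y hey hy hyp
          rw [hE] at hy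
          exact hadj e y hey hy hyp
        have hred' : ∃ e y, ends e = s(p, y) ∧ y ∈ armC ends h u (blue ζ) p ∧ y ≠ p ∧
            blue ζ e = true := by
          refine ⟨e₀, y₀, hey₀, by rw [hE]; exact hy₀.1, hy₀.2, ?_⟩
          rw [← hred₀, coreBaseOf_apply_of_mem hey₀ (hPB hpP)]
          rfl
        have key := armP_conn_red hdisj' hP' hPR' hno_u' hadj' hred' x (by rw [hE]; exact hx)
        rw [hE] at key
        exact key
    · -- a u-arm or a far arm: its u-neighbours are adjacent to `h`
      have hPu : ∀ e y, ends e = s(u, y) → y ∈ P → ∃ e', ends e' = s(y, h) := by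
        intro e y hey hyP
        refine hj.hu_adj_h e y hey ?_
        intro hyp
        exact armsC_disjoint hP hAP hPp y hyP (hyp ▸ hpP)
      rcases armsC_subset_side hnoRB hP with hPR | hPB
      · rw [insideConfig_coreBaseOf_of_subset_red hPR (Or.inl rfl) hdisj]
        exact harm_conn_red' hdisj hP hPR hPu x hx
      · rw [insideConfig_coreBaseOf_of_subset_blue hPB hj.hloop_h]
        have hP' : P ∈ armsC ends h u (blue ζ) := by rw [armsC_blue]; exact hP
        have hPR' : P ⊆ redExt ends h u (blue ζ) := by rw [redExt_blue]; exact hPB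
        exact harm_conn_red' hdisj' hP' hPR' hPu x hx
  have hnotpure : ∀ P : armsC ends h u ζ, ¬ pureC ends h P.1 := by
    intro P hpure
    obtain ⟨e, y, hey, hyP⟩ := armsC_not_pure hj hHU P.2
    exact hpure e y hey hyP
  exact
  { hne := hhu
    bdry_blue := fun e x y hxy hxH hyH => coreBaseOf_bdry_blue hdisj hxy hxH hyH
    arm_sub := fun P x hx => armsC_subset P.2 x hx
    arm_nonempty := fun P => armsC_nonempty P.2
    arm_disj := fun P P' hne x hx => armsC_disjoint P.2 P'.2 (fun h' => hne (Subtype.ext h')) x hx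
    arm_cover := by
      intro x hxH hxh hxu
      obtain ⟨P, hP, hxP⟩ := exists_armsC_of_mem hhu hxH hxh hxu
      exact ⟨⟨P, hP⟩, hxP⟩
    no_cross := fun P P' hne e x y hxy hx hy =>
      armsC_no_cross P.2 P'.2 (fun h' => hne (Subtype.ext h')) hxy hx hy
    h_edges := by
      intro e x hxe
      have hxh : x ≠ h := fun h' => hj.hloop_h e (by rw [hxe, h'])
      have hxu : x ≠ u := fun h' => hj.hnadj e (by rw [hxe, h'])
      have hxH : x ∈ extHull ends ζ h u := by
        cases he : ζ e with
        | true => exact Or.inl (Or.inl (mem_cluster_of_edge (mem_cluster_self _ _ _) he hxe))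
        | false =>
          have he' : blue ζ e = true := by rw [blue_eq_true_iff]; exact he
          exact Or.inl (Or.inr (mem_cluster_of_edge (mem_cluster_self _ _ _) he' hxe))
      obtain ⟨P, hP, hxP⟩ := exists_armsC_of_mem hhu hxH hxh hxu
      exact ⟨⟨P, hP⟩, hxP⟩
    h_red := by
      intro e x hxe
      have hxh : x ≠ h := fun h' => hj.hloop_h e (by rw [hxe, h'])
      have hxu : x ≠ u := fun h' => hj.hnadj e (by rw [hxe, h'])
      cases he : ζ e with
      | true =>
        have hxR : x ∈ redExt ends h u ζ := by
          rw [mem_redExt_iff]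
          exact ⟨Or.inl (mem_cluster_of_edge (mem_cluster_self _ _ _) he hxe), hxh, hxu⟩
        rw [coreBaseOf_apply_of_notMem hxe h_notMem_blueExt (fun h' => hdisj x hxR h'), he]
      | false =>
        have he' : blue ζ e = true := by rw [blue_eq_true_iff]; exact he
        have hxB : x ∈ blueExt ends ζ h u := by
          rw [mem_blueExt_iff]
          exact ⟨Or.inl (mem_cluster_of_edge (mem_cluster_self _ _ _) he' hxe), hxh, hxu⟩
        rw [coreBaseOf_apply_of_mem (ends_swap hxe) hxB, he]
        rfl
    u_edges := by
      intro e x hxe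
      have hxu : x ≠ u := fun h' => hj.hloop_u e (by rw [hxe, h'])
      have hxh : x ≠ h := fun h' => hj.hnadj e (by rw [hxe, h', Sym2.eq_swap])
      have hxH : x ∈ extHull ends ζ h u := by
        cases he : ζ e with
        | true => exact Or.inr (Or.inl (mem_cluster_of_edge (mem_cluster_self _ _ _) he hxe))
        | false =>
          have he' : blue ζ e = true := by rw [blue_eq_true_iff]; exact he
          exact Or.inr (Or.inr (mem_cluster_of_edge (mem_cluster_self _ _ _) he' hxe))
      obtain ⟨P, hP, hxP⟩ := exists_armsC_of_mem hhu hxH hxh hxu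
      exact ⟨⟨P, hP⟩, hxP⟩
    u_red := by
      intro e x hxe
      have hxu : x ≠ u := fun h' => hj.hloop_u e (by rw [hxe, h'])
      have hxh : x ≠ h := fun h' => hj.hnadj e (by rw [hxe, h', Sym2.eq_swap])
      cases he : ζ e with
      | true =>
        have hxR : x ∈ redExt ends h u ζ := by
          rw [mem_redExt_iff]
          exact ⟨Or.inr (mem_cluster_of_edge (mem_cluster_self _ _ _) he hxe), hxh, hxu⟩
        rw [coreBaseOf_apply_of_notMem hxe u_notMem_blueExt (fun h' => hdisj x hxR h'), he]
      | false =>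
        have he' : blue ζ e = true := by rw [blue_eq_true_iff]; exact he
        have hxB : x ∈ blueExt ends ζ h u := by
          rw [mem_blueExt_iff]
          exact ⟨Or.inr (mem_cluster_of_edge (mem_cluster_self _ _ _) he' hxe), hxh, hxu⟩
        rw [coreBaseOf_apply_of_mem (ends_swap hxe) hxB, he]
        rfl
    u_hadj := by
      obtain ⟨e, he⟩ := hj.hup
      exact ⟨⟨armC ends h u ζ p, hAP⟩, hnotpure ⟨_, hAP⟩, e, p, he, hpP⟩
    harm_conn := fun P _ x hx => hconn P.1 P.2 x hx
    pure_conn := fun P hp => absurd hp (hnotpure P)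
    pure_no_h := fun P hp => absurd hp (hnotpure P) }

end Base

end BigBlock

end Summit.Ventures.PercRepro2
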